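import Literature.MathematicalPhysics.QuantumFieldTheory.ConformalBootstrap3D.MeanFieldFormalExpansionAB
import Literature.MathematicalPhysics.QuantumFieldTheory.ConformalBootstrap3D.MeanFieldEdge
import Mathlib.Tactic
import HarnessLib

/-!
# The leading-twist edges of the mixed mean-field block sums (unequal external dimensions)

`(a,b)` version of `MeanFieldEdge`. In the frame `2s`, `s = (p+q)/2`, the entry `(M, M)` of a formal block sum
sees only the leading-twist blocks `(2s+ℓ, ℓ)`, `ℓ ≤ M`, through their leading trajectory
`A_{M-ℓ, M}(a,b; 2s+ℓ, ℓ) = (s+a+ℓ)_N (s+b+ℓ)_N (ℓ+1)_N / ((ℓ+½)_N N! (2s+2ℓ)_N)`, `N = M - ℓ` (`blockSumAB_edge`,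
`hrCoeffAB_leading_explicit`, Dolan–Osborn 2004 eqs. (3.11), (3.13)). For the two mixed mean-field families of
two decoupled generalised free fields `φ`, `χ` (dimensions `p`, `q`; coefficients `P_{0,ℓ}(p,q)/λ_ℓ`,
`P_{0,ℓ}(p,q) = (p)_ℓ (q)_ℓ/(ℓ! (p+q+ℓ-1)_ℓ)`, Fitzpatrick–Kaplan 2012 §2.2):

* `⟨σεσε⟩` family, `(a,b) = ((q-p)/2, (p-q)/2)` (so `s+a = q`, `s+b = p`), sign `(-1)^ℓ`: the edge summand is
  `(p)_M (q)_M/(1/2)_M · (-1)^ℓ t(M,ℓ)` with the SAME hypergeometric term `t = ltTerm s` as in the equal case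
  (`x = 2s-1 = p+q-1`), so the edge is `δ_{M,0}` by `leadingTwistSum_alt` (`blockSumAB_mftI_edge`);
* `⟨εσσε⟩` family, `(a,b) = ((p-q)/2, (p-q)/2)` (`s+a = s+b = p`): the edge summand is
  `(p)_M/(1/2)_M · T(M,ℓ)`, `T(M,ℓ) = t(M,ℓ) (q)_ℓ (p)_M/(p)_ℓ` (`ltTermII`), and `Σ_{ℓ ≤ M} T(M,ℓ) = 1`
  (`leadingTwistSumII_one`) — a terminating very-well-poised `₄F₃(-1)` summation, proved here by the explicit
  WZ pair `T(M+1,ℓ) - T(M,ℓ) = G(M,ℓ+1) - G(M,ℓ)`, `G(M,ℓ) = -ℓ (p+ℓ-1) C(M+1,ℓ) (q)_ℓ (p)_M / ((p)_ℓ (M+1) (x+ℓ)_{M+1})`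
  (`ltCertII`, `ltTermII_wz_step`; found and validated in exact arithmetic, pub-ising3d-lit-g10
  `code/ab_edge_cert.py`), so the edge is `(p)_M/(1/2)_M = gg(p; 0, M)` (`blockSumAB_mftII_edge`, `ggArr_edge`).

Finite algebra throughout. [cite: FitzpatrickKaplan2012, §2.2] [cite: DolanOsborn2004, §3 eqs. (3.11), (3.13)]
-/

namespace Literature.MathematicalPhysics.QuantumFieldTheory.ConformalBootstrap3D

open Finset

/-! ### The leading trajectory of a leading-twist block with parameters `(a,b)` -/

/-- The leading trajectory of the leading-twist block `(2s+ℓ, ℓ)` with parameters `(a,b)` in Pochhammer form: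
`A_{N,ℓ+N}(a,b; 2s+ℓ, ℓ) = (s+a+ℓ)_N (s+b+ℓ)_N (ℓ+1)_N / ((ℓ+1/2)_N N! (2s+2ℓ)_N)` (Dolan–Osborn 2004 eq. (3.11),
(3.13) at `λ₁ = s + ℓ`). [cite: DolanOsborn2004, §3 eqs. (3.11), (3.13)] -/
theorem hrCoeffAB_leading_twist (a b s : ℝ) (ℓ N : ℕ) :
    hrCoeffAB a b (2 * s + ℓ) ℓ N (ℓ + N) =
      poch (s + a + ℓ) N * poch (s + b + ℓ) N * poch ((ℓ : ℝ) + 1) N /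
        (poch ((ℓ : ℝ) + 1 / 2) N * (N.factorial : ℝ) * poch (2 * s + 2 * ℓ) N) := by
  rw [hrCoeffAB_leading_explicit]
  induction N with
  | zero => simp
  | succ N ih =>
    rw [prod_range_succ, ih, poch_succ, poch_succ, poch_succ, poch_succ, poch_succ, Nat.factorial_succ]
    have hl : (0 : ℝ) ≤ ℓ := Nat.cast_nonneg ℓ
    have hN : (0 : ℝ) ≤ N := Nat.cast_nonneg N
    have h1 : poch ((ℓ : ℝ) + 1 / 2) N ≠ 0 := poch_ne_zero (by linarith) N
    have h2 : (N.factorial : ℝ) ≠ 0 := by positivity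
    have h4 : (2 * (ℓ : ℝ) + 2 * N + 1) ≠ 0 := by positivity
    have h5 : (2 * ((N : ℝ) + 1)) ≠ 0 := by positivity
    -- `(2s+2ℓ)_N` and `2s+ℓ+ℓ+N` may vanish for non-positive `s`; treat by cases to stay unconditional
    by_cases h3 : poch (2 * s + 2 * ℓ) N = 0
    · simp [h3]
    by_cases h6 : (2 * s + ℓ + ℓ + N) = 0
    · have : (2 * s + 2 * ℓ + N) = 0 := by linarith
      simp [this, h6]
    have h6' : (2 * s + 2 * ℓ + N) ≠ 0 := by intro h; apply h6; linarith
    push_cast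
    field_simp
    ring

/-! ### The `⟨σεσε⟩` edge: reduction to the equal-case alternating sum -/

/-- **The edge summand of the `⟨σεσε⟩` mean-field block sum, reduced**: for `ℓ ≤ M`, `s = (p+q)/2`,
`(a,b) = ((q-p)/2, (p-q)/2)`, `(P_{0,ℓ}(p,q)/λ_ℓ) · A_{M-ℓ,M}(a,b; 2s+ℓ, ℓ) = (p)_M (q)_M/(1/2)_M · t(M,ℓ)` with
`t = ltTerm s` (`x = 2s - 1 = p + q - 1`; `p, q > 1/2`). [cite: FitzpatrickKaplan2012, §2.2] -/
theorem mftAB_edge_term_I {p q : ℝ} (hp : 1 / 2 < p) (hq : 1 / 2 < q) {M ℓ : ℕ} (hℓ : ℓ ≤ M) :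
    mftCoeffAB p q 0 ℓ / legendreLam ℓ *
        hrCoeffAB ((q - p) / 2) ((p - q) / 2) (2 * ((p + q) / 2) + ℓ) ℓ (M - ℓ) M =
      poch p M * poch q M / poch (1 / 2) M * ltTerm ((p + q) / 2) M ℓ := by
  obtain ⟨N, rfl⟩ : ∃ N, M = ℓ + N := ⟨M - ℓ, by omega⟩
  rw [Nat.add_sub_cancel_left, hrCoeffAB_leading_twist, mftCoeffAB_zero_left, legendreLam_eq_poch]
  unfold ltTerm
  have es1 : (p + q) / 2 + (q - p) / 2 + (ℓ : ℝ) = q + ℓ := by ring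
  have es2 : (p + q) / 2 + (p - q) / 2 + (ℓ : ℝ) = p + ℓ := by ring
  have es3 : 2 * ((p + q) / 2) + 2 * (ℓ : ℝ) = p + q + 2 * ℓ := by ring
  have es4 : 2 * ((p + q) / 2) - 1 + (ℓ : ℝ) = p + q - 1 + ℓ := by ring
  have es5 : 2 * ((p + q) / 2) - 1 + 2 * (ℓ : ℝ) = p + q - 1 + 2 * ℓ := by ring
  rw [es1, es2, es3, es4, es5]
  -- Pochhammer bookkeeping
  have ePM : poch p (ℓ + N) = poch p ℓ * poch (p + ℓ) N := poch_add p ℓ N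
  have eQM : poch q (ℓ + N) = poch q ℓ * poch (q + ℓ) N := poch_add q ℓ N
  have eH : poch (1 / 2) (ℓ + N) = poch (1 / 2) ℓ * poch ((ℓ : ℝ) + 1 / 2) N := by
    rw [poch_add]; ring_nf
  have eF : poch ((ℓ : ℝ) + 1) N * (ℓ.factorial : ℝ) = ((ℓ + N).factorial : ℝ) := poch_succ_nat_mul_factorial ℓ N
  have eX : poch (p + q - 1 + ℓ) (ℓ + N + 1) =
      poch (p + q + ℓ - 1) ℓ * (p + q - 1 + 2 * ℓ) * poch (p + q + 2 * ℓ) N := by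
    rw [show ℓ + N + 1 = ℓ + (N + 1) by ring, poch_add, poch_succ_left]
    ring_nf
  have eC : ((ℓ + N).choose ℓ : ℝ) * ((ℓ.factorial : ℝ) * (N.factorial : ℝ)) = ((ℓ + N).factorial : ℝ) := by
    have h := Nat.choose_mul_factorial_mul_factorial (show ℓ ≤ ℓ + N by omega)
    rw [Nat.add_sub_cancel_left] at h
    exact_mod_cast (by rw [← mul_assoc]; exact h)
  -- positivity of everything in sight
  have hl0 : (0 : ℝ) ≤ ℓ := Nat.cast_nonneg ℓ
  have f1 : (ℓ.factorial : ℝ) ≠ 0 := by positivity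
  have f2 : (N.factorial : ℝ) ≠ 0 := by positivity
  have f3 : ((ℓ + N).factorial : ℝ) ≠ 0 := by positivity
  have q1 : poch (1 / 2) ℓ ≠ 0 := poch_ne_zero (by norm_num) ℓ
  have q2 : poch ((ℓ : ℝ) + 1 / 2) N ≠ 0 := poch_ne_zero (by linarith) N
  have q3 : poch (p + q + ℓ - 1) ℓ ≠ 0 := poch_ne_zero (by linarith) ℓ
  have q4 : poch (p + q + 2 * ℓ) N ≠ 0 := poch_ne_zero (by linarith) N
  have q5 : (p + q - 1 + 2 * (ℓ : ℝ)) ≠ 0 := by intro h; linarith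
  have q6 : poch p ℓ ≠ 0 := poch_ne_zero (by linarith) ℓ
  have q7 : poch (p + ℓ) N ≠ 0 := poch_ne_zero (by linarith) N
  have q6' : poch q ℓ ≠ 0 := poch_ne_zero (by linarith) ℓ
  have q7' : poch (q + ℓ) N ≠ 0 := poch_ne_zero (by linarith) N
  have q8 : poch ((ℓ : ℝ) + 1) N ≠ 0 := poch_ne_zero (by linarith) N
  have q5' : p + q - 1 + (ℓ : ℝ) * 2 ≠ 0 := by intro h; linarith
  have q2' : poch (((ℓ : ℝ) * 2 + 1) / 2) N ≠ 0 := by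
    rw [show ((ℓ : ℝ) * 2 + 1) / 2 = (ℓ : ℝ) + 1 / 2 by ring]; exact q2
  have q4' : poch (p + q + (ℓ : ℝ) * 2) N ≠ 0 := by
    rw [show p + q + (ℓ : ℝ) * 2 = p + q + 2 * ℓ by ring]; exact q4
  rw [ePM, eQM, eH, eX]
  rw [show poch ((ℓ : ℝ) + 1) N = ((ℓ + N).factorial : ℝ) / (ℓ.factorial : ℝ) by rw [eq_div_iff f1, eF],
    show (((ℓ + N).choose ℓ : ℕ) : ℝ) = ((ℓ + N).factorial : ℝ) / ((ℓ.factorial : ℝ) * (N.factorial : ℝ)) by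
      rw [eq_div_iff (mul_ne_zero f1 f2), eC]]
  field_simp

/-- **Edge of the `⟨σεσε⟩` mean-field block sum**: with `s = (p+q)/2`, `(a,b) = ((q-p)/2, (p-q)/2)`,
`blockSumAB a b s ((-1)^ℓ P_{n,ℓ}(p,q)/λ_ℓ) M M = δ_{M,0}`. [cite: FitzpatrickKaplan2012, §2.2] -/
theorem blockSumAB_mftI_edge {p q : ℝ} (hp : 1 / 2 < p) (hq : 1 / 2 < q) (M : ℕ) :
    blockSumAB ((q - p) / 2) ((p - q) / 2) ((p + q) / 2)
        (fun n ℓ => (-1 : ℝ) ^ ℓ * mftCoeffAB p q n ℓ / legendreLam ℓ) M M = if M = 0 then 1 else 0 := by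
  have hs : 1 / 2 < (p + q) / 2 := by linarith
  rw [blockSumAB_edge]
  have h : ∑ ℓ ∈ range (M + 1), (-1 : ℝ) ^ ℓ * mftCoeffAB p q 0 ℓ / legendreLam ℓ *
        hrCoeffAB ((q - p) / 2) ((p - q) / 2) (2 * ((p + q) / 2) + ℓ) ℓ (M - ℓ) M =
      poch p M * poch q M / poch (1 / 2) M * ∑ ℓ ∈ range (M + 1), (-1 : ℝ) ^ ℓ * ltTerm ((p + q) / 2) M ℓ := by
    rw [mul_sum]
    refine sum_congr rfl fun ℓ hℓ => ?_
    rw [mem_range] at hℓ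
    have h := mftAB_edge_term_I hp hq (show ℓ ≤ M by omega)
    calc (-1 : ℝ) ^ ℓ * mftCoeffAB p q 0 ℓ / legendreLam ℓ *
          hrCoeffAB ((q - p) / 2) ((p - q) / 2) (2 * ((p + q) / 2) + ℓ) ℓ (M - ℓ) M
        = (-1 : ℝ) ^ ℓ * (mftCoeffAB p q 0 ℓ / legendreLam ℓ *
          hrCoeffAB ((q - p) / 2) ((p - q) / 2) (2 * ((p + q) / 2) + ℓ) ℓ (M - ℓ) M) := by ring
      _ = poch p M * poch q M / poch (1 / 2) M * ((-1 : ℝ) ^ ℓ * ltTerm ((p + q) / 2) M ℓ) := by rw [h]; ring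
  rw [h, leadingTwistSum_alt hs]
  split_ifs with h0
  · subst h0; simp
  · simp

/-! ### The `⟨εσσε⟩` edge: a very-well-poised sum by an explicit WZ pair -/

/-- The `⟨εσσε⟩` edge summand `T(M,ℓ) = t(M,ℓ) (q)_ℓ (p)_M/(p)_ℓ`, `t = ltTerm ((p+q)/2)` (i.e.
`C(M,ℓ)(x+2ℓ)(q)_ℓ (p+ℓ)_{M-ℓ}/(x+ℓ)_{M+1}`, `x = p+q-1`). [folklore] -/
noncomputable def ltTermII (p q : ℝ) (M ℓ : ℕ) : ℝ :=
  ltTerm ((p + q) / 2) M ℓ * (poch q ℓ * poch p M / poch p ℓ)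

/-- The WZ certificate `G(M,ℓ) = -ℓ (p+ℓ-1) C(M+1,ℓ) (q)_ℓ (p)_M / ((p)_ℓ (M+1) (x+ℓ)_{M+1})`, `x = p+q-1`. [folklore] -/
noncomputable def ltCertII (p q : ℝ) (M ℓ : ℕ) : ℝ :=
  -((ℓ : ℝ) * (p + ℓ - 1) * ((M + 1).choose ℓ : ℝ) * poch q ℓ * poch p M) /
    (poch p ℓ * ((M : ℝ) + 1) * poch (p + q - 1 + ℓ) (M + 1))

/-- `G(M,0) = 0`. [folklore] -/
theorem ltCertII_zero (p q : ℝ) (M : ℕ) : ltCertII p q M 0 = 0 := by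
  simp [ltCertII]

set_option maxHeartbeats 1600000 in
/-- **The WZ step** `T(M+1,ℓ) - T(M,ℓ) = G(M,ℓ+1) - G(M,ℓ)` for `ℓ ≤ M` (`p, q > 1/2`). [folklore] -/
theorem ltTermII_wz_step {p q : ℝ} (hp : 1 / 2 < p) (hq : 1 / 2 < q) {M ℓ : ℕ} (hℓ : ℓ ≤ M) :
    ltTermII p q (M + 1) ℓ - ltTermII p q M ℓ = ltCertII p q M (ℓ + 1) - ltCertII p q M ℓ := by
  unfold ltTermII ltCertII ltTerm
  have hl0 : (0 : ℝ) ≤ ℓ := Nat.cast_nonneg ℓ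
  have hM0 : (0 : ℝ) ≤ M := Nat.cast_nonneg M
  have hx : 0 < p + q - 1 + ℓ := by linarith
  have es4 : 2 * ((p + q) / 2) - 1 + (ℓ : ℝ) = p + q - 1 + ℓ := by ring
  have es5 : 2 * ((p + q) / 2) - 1 + 2 * (ℓ : ℝ) = p + q - 1 + 2 * ℓ := by ring
  rw [es4, es5]
  set P := poch (p + q - 1 + ℓ) (M + 1) with hPdef
  have hP : P ≠ 0 := poch_ne_zero hx (M + 1)
  -- Pochhammer relations for the `x`-symbols
  have e1 : poch (p + q - 1 + ℓ) (M + 1 + 1) = P * (p + q + ℓ + M) := by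
    rw [hPdef, poch_succ]; push_cast; ring
  have e2 : poch (p + q - 1 + ↑(ℓ + 1)) (M + 1) = P * (p + q + ℓ + M) / (p + q - 1 + ℓ) := by
    rw [eq_div_iff hx.ne', hPdef]
    have := poch_succ_left (p + q - 1 + ℓ) (M + 1)
    rw [poch_succ] at this
    push_cast at this ⊢
    rw [show p + q - 1 + ((ℓ : ℝ) + 1) = p + q - 1 + ℓ + 1 by ring]
    linear_combination (-1 : ℝ) * this
  -- Pochhammer relations for `(q)_ℓ`, `(p)_ℓ`, `(p)_M`
  have e3 : poch q (ℓ + 1) = poch q ℓ * (q + ℓ) := poch_succ q ℓ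
  have e4 : poch p (ℓ + 1) = poch p ℓ * (p + ℓ) := poch_succ p ℓ
  have e5 : poch p (M + 1) = poch p M * (p + M) := poch_succ p M
  -- binomial relations (as reals)
  have hb : (((M + 1).choose ℓ : ℕ) : ℝ) * ((M : ℝ) + 1 - ℓ) = (M.choose ℓ : ℝ) * ((M : ℝ) + 1) := by
    have h := Nat.choose_mul_succ_eq M ℓ
    have h' : ((M.choose ℓ * (M + 1) : ℕ) : ℝ) = (((M + 1).choose ℓ * (M + 1 - ℓ) : ℕ) : ℝ) := by rw [h]
    push_cast [Nat.cast_sub (show ℓ ≤ M + 1 by omega)] at h'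
    linarith [h']
  have ha : (((M + 1).choose (ℓ + 1) : ℕ) : ℝ) * ((ℓ : ℝ) + 1) = ((M : ℝ) + 1) * (M.choose ℓ : ℝ) := by
    have h := Nat.add_one_mul_choose_eq M ℓ
    have h' : (((M + 1) * M.choose ℓ : ℕ) : ℝ) = (((M + 1).choose (ℓ + 1) * (ℓ + 1) : ℕ) : ℝ) := by rw [h]
    push_cast at h'
    linarith [h']
  have hMl : ((M : ℝ) + 1 - ℓ) ≠ 0 := by
    have : (ℓ : ℝ) ≤ M := by exact_mod_cast hℓ
    linarith
  have hM1 : ((M : ℝ) + 1) ≠ 0 := by positivity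
  have hl1 : ((ℓ : ℝ) + 1) ≠ 0 := by positivity
  have hxM : (p + q + (ℓ : ℝ) + M) ≠ 0 := by intro h; linarith
  have hpl : poch p ℓ ≠ 0 := poch_ne_zero (by linarith) ℓ
  have hpl' : (p + (ℓ : ℝ)) ≠ 0 := by intro h; linarith
  have hql : poch q ℓ ≠ 0 := poch_ne_zero (by linarith) ℓ
  have hpM : poch p M ≠ 0 := poch_ne_zero (by linarith) M
  have hxl : (p + q - 1 + (ℓ : ℝ)) ≠ 0 := hx.ne'
  rw [show (((M + 1).choose ℓ : ℕ) : ℝ) = (M.choose ℓ : ℝ) * ((M : ℝ) + 1) / ((M : ℝ) + 1 - ℓ) by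
      rw [eq_div_iff hMl, hb],
    show (((M + 1).choose (ℓ + 1) : ℕ) : ℝ) = ((M : ℝ) + 1) * (M.choose ℓ : ℝ) / ((ℓ : ℝ) + 1) by
      rw [eq_div_iff hl1, ha], e1, e2, e3, e4, e5]
  push_cast
  field_simp
  ring

/-- The boundary identity `T(M+1,M+1) + G(M,M+1) = 0`. [folklore] -/
theorem ltTermII_boundary {p q : ℝ} (hp : 1 / 2 < p) (hq : 1 / 2 < q) (M : ℕ) :
    ltTermII p q (M + 1) (M + 1) + ltCertII p q M (M + 1) = 0 := by
  unfold ltTermII ltCertII ltTerm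
  have hM0 : (0 : ℝ) ≤ M := Nat.cast_nonneg M
  rw [Nat.choose_self]
  push_cast
  have es4 : 2 * ((p + q) / 2) - 1 + ((M : ℝ) + 1) = p + q + M := by ring
  have es5 : 2 * ((p + q) / 2) - 1 + 2 * ((M : ℝ) + 1) = p + q + 2 * M + 1 := by ring
  have es6 : p + q - 1 + ((M : ℝ) + 1) = p + q + M := by ring
  rw [es4, es5, es6, poch_succ (p + q + M) (M + 1), poch_succ p M]
  push_cast
  have hP : poch (p + q + M) (M + 1) ≠ 0 := poch_ne_zero (by linarith) _
  have hq' : (p + q + (M : ℝ) + ((M : ℝ) + 1)) ≠ 0 := by intro h; linarith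
  have hpM : poch p M ≠ 0 := poch_ne_zero (by linarith) M
  have hpM' : (p + (M : ℝ)) ≠ 0 := by intro h; linarith
  have hM1 : ((M : ℝ) + 1) ≠ 0 := by positivity
  have hqM : poch q (M + 1) ≠ 0 := poch_ne_zero (by linarith) _
  field_simp
  ring

/-- **The `⟨εσσε⟩` leading-twist sum**: `Σ_{ℓ ≤ M} T(M,ℓ) = 1` for every `M` (`p, q > 1/2`) — the terminating
very-well-poised summation `₄F₃[x, x/2+1, q, -M; x/2, p, x+M+1; -1] = (x+1)_M/(p)_M`, `x = p+q-1`, in WZ form.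
[folklore] -/
theorem leadingTwistSumII_one {p q : ℝ} (hp : 1 / 2 < p) (hq : 1 / 2 < q) (M : ℕ) :
    ∑ ℓ ∈ range (M + 1), ltTermII p q M ℓ = 1 := by
  induction M with
  | zero =>
    have hx : (2 * ((p + q) / 2) - 1) ≠ 0 := by intro h; linarith
    have hp0 : poch p 0 ≠ 0 := by simp
    simp [ltTermII, ltTerm, poch_one, hx]
  | succ M ih =>
    -- `S(M+1) = S(M)`: telescoping over `ℓ ≤ M` plus the last term `ℓ = M+1`
    rw [sum_range_succ]
    have htel : ∑ ℓ ∈ range (M + 1), ltTermII p q (M + 1) ℓ =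
        ∑ ℓ ∈ range (M + 1), ltTermII p q M ℓ + (ltCertII p q M (M + 1) - ltCertII p q M 0) := by
      rw [← sum_range_sub (ltCertII p q M), ← sum_add_distrib]
      refine sum_congr rfl fun ℓ hℓ => ?_
      rw [mem_range] at hℓ
      linarith [ltTermII_wz_step hp hq (show ℓ ≤ M by omega)]
    rw [htel, ih, ltCertII_zero]
    linarith [ltTermII_boundary hp hq M]

/-- **The edge summand of the `⟨εσσε⟩` mean-field block sum, reduced**: for `ℓ ≤ M`, `s = (p+q)/2`,
`(a,b) = ((p-q)/2, (p-q)/2)`, `(P_{0,ℓ}(p,q)/λ_ℓ) · A_{M-ℓ,M}(a,b; 2s+ℓ, ℓ) = (p)_M/(1/2)_M · T(M,ℓ)`.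
[cite: FitzpatrickKaplan2012, §2.2] -/
theorem mftAB_edge_term_II {p q : ℝ} (hp : 1 / 2 < p) (hq : 1 / 2 < q) {M ℓ : ℕ} (hℓ : ℓ ≤ M) :
    mftCoeffAB p q 0 ℓ / legendreLam ℓ *
        hrCoeffAB ((p - q) / 2) ((p - q) / 2) (2 * ((p + q) / 2) + ℓ) ℓ (M - ℓ) M =
      poch p M / poch (1 / 2) M * ltTermII p q M ℓ := by
  obtain ⟨N, rfl⟩ : ∃ N, M = ℓ + N := ⟨M - ℓ, by omega⟩
  rw [Nat.add_sub_cancel_left, hrCoeffAB_leading_twist, mftCoeffAB_zero_left, legendreLam_eq_poch]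
  unfold ltTermII ltTerm
  have es2 : (p + q) / 2 + (p - q) / 2 + (ℓ : ℝ) = p + ℓ := by ring
  have es3 : 2 * ((p + q) / 2) + 2 * (ℓ : ℝ) = p + q + 2 * ℓ := by ring
  have es4 : 2 * ((p + q) / 2) - 1 + (ℓ : ℝ) = p + q - 1 + ℓ := by ring
  have es5 : 2 * ((p + q) / 2) - 1 + 2 * (ℓ : ℝ) = p + q - 1 + 2 * ℓ := by ring
  rw [es2, es3, es4, es5]
  -- Pochhammer bookkeeping
  have ePM : poch p (ℓ + N) = poch p ℓ * poch (p + ℓ) N := poch_add p ℓ N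
  have eH : poch (1 / 2) (ℓ + N) = poch (1 / 2) ℓ * poch ((ℓ : ℝ) + 1 / 2) N := by
    rw [poch_add]; ring_nf
  have eF : poch ((ℓ : ℝ) + 1) N * (ℓ.factorial : ℝ) = ((ℓ + N).factorial : ℝ) := poch_succ_nat_mul_factorial ℓ N
  have eX : poch (p + q - 1 + ℓ) (ℓ + N + 1) =
      poch (p + q + ℓ - 1) ℓ * (p + q - 1 + 2 * ℓ) * poch (p + q + 2 * ℓ) N := by
    rw [show ℓ + N + 1 = ℓ + (N + 1) by ring, poch_add, poch_succ_left]
    ring_nf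
  have eC : ((ℓ + N).choose ℓ : ℝ) * ((ℓ.factorial : ℝ) * (N.factorial : ℝ)) = ((ℓ + N).factorial : ℝ) := by
    have h := Nat.choose_mul_factorial_mul_factorial (show ℓ ≤ ℓ + N by omega)
    rw [Nat.add_sub_cancel_left] at h
    exact_mod_cast (by rw [← mul_assoc]; exact h)
  -- positivity of everything in sight
  have hl0 : (0 : ℝ) ≤ ℓ := Nat.cast_nonneg ℓ
  have f1 : (ℓ.factorial : ℝ) ≠ 0 := by positivity
  have f2 : (N.factorial : ℝ) ≠ 0 := by positivity
  have f3 : ((ℓ + N).factorial : ℝ) ≠ 0 := by positivity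
  have q1 : poch (1 / 2) ℓ ≠ 0 := poch_ne_zero (by norm_num) ℓ
  have q2 : poch ((ℓ : ℝ) + 1 / 2) N ≠ 0 := poch_ne_zero (by linarith) N
  have q3 : poch (p + q + ℓ - 1) ℓ ≠ 0 := poch_ne_zero (by linarith) ℓ
  have q4 : poch (p + q + 2 * ℓ) N ≠ 0 := poch_ne_zero (by linarith) N
  have q5 : (p + q - 1 + 2 * (ℓ : ℝ)) ≠ 0 := by intro h; linarith
  have q6 : poch p ℓ ≠ 0 := poch_ne_zero (by linarith) ℓ
  have q7 : poch (p + ℓ) N ≠ 0 := poch_ne_zero (by linarith) N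
  have q6' : poch q ℓ ≠ 0 := poch_ne_zero (by linarith) ℓ
  have q8 : poch ((ℓ : ℝ) + 1) N ≠ 0 := poch_ne_zero (by linarith) N
  have q5' : p + q - 1 + (ℓ : ℝ) * 2 ≠ 0 := by intro h; linarith
  have q2' : poch (((ℓ : ℝ) * 2 + 1) / 2) N ≠ 0 := by
    rw [show ((ℓ : ℝ) * 2 + 1) / 2 = (ℓ : ℝ) + 1 / 2 by ring]; exact q2
  have q4' : poch (p + q + (ℓ : ℝ) * 2) N ≠ 0 := by
    rw [show p + q + (ℓ : ℝ) * 2 = p + q + 2 * ℓ by ring]; exact q4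
  rw [ePM, eH, eX]
  rw [show poch ((ℓ : ℝ) + 1) N = ((ℓ + N).factorial : ℝ) / (ℓ.factorial : ℝ) by rw [eq_div_iff f1, eF],
    show (((ℓ + N).choose ℓ : ℕ) : ℝ) = ((ℓ + N).factorial : ℝ) / ((ℓ.factorial : ℝ) * (N.factorial : ℝ)) by
      rw [eq_div_iff (mul_ne_zero f1 f2), eC]]
  field_simp

/-- **Edge of the `⟨εσσε⟩` mean-field block sum**: with `s = (p+q)/2`, `(a,b) = ((p-q)/2, (p-q)/2)`,
`blockSumAB a b s (P_{n,ℓ}(p,q)/λ_ℓ) M M = (p)_M/(1/2)_M` (`= gg(p; 0, M)`, `ggArr_edge`). [cite: FitzpatrickKaplan2012, §2.2] -/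
theorem blockSumAB_mftII_edge {p q : ℝ} (hp : 1 / 2 < p) (hq : 1 / 2 < q) (M : ℕ) :
    blockSumAB ((p - q) / 2) ((p - q) / 2) ((p + q) / 2)
        (fun n ℓ => (1 : ℝ) * mftCoeffAB p q n ℓ / legendreLam ℓ) M M = poch p M / poch (1 / 2) M := by
  rw [blockSumAB_edge]
  have h : ∑ ℓ ∈ range (M + 1), (1 : ℝ) * mftCoeffAB p q 0 ℓ / legendreLam ℓ *
        hrCoeffAB ((p - q) / 2) ((p - q) / 2) (2 * ((p + q) / 2) + ℓ) ℓ (M - ℓ) M =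
      poch p M / poch (1 / 2) M * ∑ ℓ ∈ range (M + 1), ltTermII p q M ℓ := by
    rw [mul_sum]
    refine sum_congr rfl fun ℓ hℓ => ?_
    rw [mem_range] at hℓ
    rw [one_mul]
    exact mftAB_edge_term_II hp hq (show ℓ ≤ M by omega)
  rw [h, leadingTwistSumII_one hp hq, mul_one]

end Literature.MathematicalPhysics.QuantumFieldTheory.ConformalBootstrap3D
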